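import Summits.HodgeConjecture.HodgeConjecture.Theorems.F0P3cStCharTSStrictDerivNewton   -- ★ p851993 (this seat) FILE 2: `exists_depth_chart`
import Mathlib.Analysis.Calculus.FDeriv.Prod
import HarnessLib

/-!
# F0 · P3c · ROAD «HC-D» (holder F0P2-p01) — D2 «SUBMERSION CHART»: a strictly differentiable map with SURJECTIVE derivative integrates, on every small box, like its affine
# linearisation `v ↦ P x₀ + P′ v` (exactly — no Jacobian, no inequality), and maps boxes onto affine images of boxes

Cell `pub/hodgecm-mathlib`, crux H413 = `stmt-HodgeConjecture-24833` (lane `--supports … --as helper`), route HCCMUnconditional; ROAD «HC-D» brick D2 (census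
`F0/P2/p01/g23/CENSUS-HCD.v1.F0P2p01g23.md` §2).  THEOREMS ONLY; ★-only imports.  Consumer: the REGULAR case (i) of the road (submersion straightening of the Chevalley map
`χ : 𝔤′ → F × E⁻` at a regular element: `∫⁻_{box} |δ (χ (X₀ + Y))|^{−1∕2} = ∫⁻_{box} |δ (χ X₀ + dχ Y)|^{−1∕2}`, then the LINEAR submersion bound D2-lin (LH10-p01) and the plane-cusp
integral D3c (F0P2-p02)); also any «straighten a submersion» step of D5.  HONEST LABEL: HC_CM is proved only modulo the 7 printed citations (2 remaining named inputs:
hLiu418 = `stmt-HodgeConjecture-24832`, h413 = `stmt-HodgeConjecture-24833`) until rung 0 closes; count-neutral.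

THE TRICK.  If `P : V → A` has strict derivative `P′` at `x₀` and `P′` has a continuous linear RIGHT INVERSE `s` (`P′ ∘ s = id`; in finite dimension: `P′` onto), then
`Ψ v := (P v, v − s (P′ v)) : V → A × ker P′` has strict derivative the continuous linear EQUIVALENCE `e v := (P′ v, v − s (P′ v))` (inverse `(a, k) ↦ s a + k`), so ★ FILE 2
`exists_depth_chart` applies to `Ψ`; reading its integration formula on functions `f ∘ Prod.fst` gives
  `∫⁻ v in Λ k, f (P (x₀ + v)) ∂μ = ∫⁻ v in Λ k, f (P x₀ + P′ v) ∂μ`   (every measurable `f : A → ℝ≥0∞`, every `k ≥ k₀`),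
and reading its coset-image formula through `Prod.fst` gives `P '' (x₀ +ᵥ Λ k) = P x₀ +ᵥ P′ '' Λ k`.
* §1 no definitions: the equivalence `e` is built inline by `ContinuousLinearEquiv.equivOfInverse` and exported existentially (`exists_splitting_chart`).
* §2 **`exists_depth_submersion`** (the two displayed conclusions at a common depth `k₀`), the measure-free `exists_depth_image_box_eq_linear`, and `exists_depth_lintegral_comp_eq_linear`.

## References
* [Schikhof1984] W. H. Schikhof, *Ultrametric Calculus* (1984), §27 Lemma 27.4–Thm. 27.5; §77 (several variables).
* [Serre1992LALG] J.-P. Serre, *Lie Algebras and Lie Groups*, LNM 1500 (1992), Part II Ch. III §10 (submersions over complete fields), Ch. IV §9.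
-/

set_option autoImplicit false
-- the mandated namespace has the single-problem summit's repeated segment (`HodgeConjecture.HodgeConjecture`)
set_option linter.dupNamespace false

noncomputable section

open MeasureTheory Filter Metric Set
open scoped Topology Pointwise ENNReal
open Summit.HodgeConjecture.HodgeConjecture.Cruxes.H413.F0P3cStCharTSStrictDerivNewton

namespace Summit.HodgeConjecture.HodgeConjecture.Cruxes.H413.F0P3cStCharTSSubmersionChart

variable {𝕜 : Type*} [NontriviallyNormedField 𝕜]
  {V : Type*} [NormedAddCommGroup V] [NormedSpace 𝕜 V]
  {A : Type*} [NormedAddCommGroup A] [NormedSpace 𝕜 A]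

/-! ## §1 The splitting `V ≃ A × ker P′` attached to a right inverse, and the splitting chart -/

/-- The kernel component `v − s (P′ v)` lies in `ker P′` when `P′ ∘ s = id`. [cite: Serre1992LALG, Part II Ch. III §10] -/
theorem sub_rightInverse_mem_ker (P' : V →L[𝕜] A) (s : A →L[𝕜] V) (hs : ∀ a, P' (s a) = a) (v : V) :
    v - s (P' v) ∈ LinearMap.ker (P' : V →ₗ[𝕜] A) := by
  simp [LinearMap.mem_ker, map_sub, hs]

/-- **The splitting chart.**  If `P′ : V →L[𝕜] A` has a continuous linear right inverse `s` and `P` has strict derivative `P′` at `x₀`, then there are a continuous linear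
EQUIVALENCE `e : V ≃L[𝕜] A × ker P′` and a map `Ψ : V → A × ker P′` with strict derivative `e` at `x₀` whose first components are `P′` and `P` respectively
(`e v = (P′ v, v − s (P′ v))`, `Ψ v = (P v, v − s (P′ v))`). [cite: Serre1992LALG, Part II Ch. III §10] -/
theorem exists_splitting_chart (P' : V →L[𝕜] A) (s : A →L[𝕜] V) (hs : ∀ a, P' (s a) = a) {P : V → A} {x₀ : V}
    (hP : HasStrictFDerivAt P P' x₀) :
    ∃ (e : V ≃L[𝕜] A × LinearMap.ker (P' : V →ₗ[𝕜] A)) (Ψ : V → A × LinearMap.ker (P' : V →ₗ[𝕜] A)),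
      HasStrictFDerivAt Ψ (e : V →L[𝕜] A × LinearMap.ker (P' : V →ₗ[𝕜] A)) x₀ ∧ (∀ v, (Ψ v).1 = P v) ∧ (∀ v, (e v).1 = P' v) ∧ Ψ x₀ = (P x₀, (e x₀).2) := by
  set K := LinearMap.ker (P' : V →ₗ[𝕜] A) with hK
  have hmem : ∀ v, (ContinuousLinearMap.id 𝕜 V - s.comp P') v ∈ K := fun v => by
    simp only [sub_apply, ContinuousLinearMap.coe_id', id_eq, ContinuousLinearMap.coe_comp,
      Function.comp_apply]
    exact sub_rightInverse_mem_ker P' s hs v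
  let q : V →L[𝕜] K := (ContinuousLinearMap.id 𝕜 V - s.comp P').codRestrict K hmem
  let eL : V →L[𝕜] A × K := P'.prod q
  let eR : A × K →L[𝕜] V := s.coprod K.subtypeL
  have hq : ∀ v, (q v : V) = v - s (P' v) := fun v => rfl
  have h₁ : Function.LeftInverse eR eL := by
    intro v
    simp [eL, eR, hq]
  have h₂ : Function.RightInverse eR eL := by
    rintro ⟨a, ⟨k, hk⟩⟩
    have hk' : P' k = 0 := hk
    ext
    · simp [eL, eR, map_add, hs, hk']
    · simp [eL, eR, hq, map_add, hs, hk']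
  let e : V ≃L[𝕜] A × K := ContinuousLinearEquiv.equivOfInverse eL eR h₁ h₂
  refine ⟨e, fun v => (P v, q v), ?_, fun v => rfl, fun v => rfl, ?_⟩
  · have h := HasStrictFDerivAt.prodMk hP (q.hasStrictFDerivAt (x := x₀))
    have heq : (e : V →L[𝕜] A × K) = P'.prod q := by
      ext v <;> rfl
    rw [heq]
    exact h
  · rfl

variable [IsUltrametricDist V] [ProperSpace V]

/-! ## §2 The submersion chart -/

/-- **Boxes onto affine images of boxes** (measure-free): `P '' (x₀ +ᵥ Λ k) = P x₀ +ᵥ P′ '' Λ k` for every `k ≥ k₀`; in particular the image of every small box around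
`x₀` is an OPEN affine image of a box when `P′` is onto. [cite: Schikhof1984, §27 Lemma 27.4–Thm. 27.5] [cite: Serre1992LALG, Part II Ch. III §10] -/
theorem exists_depth_image_box_eq_linear {P : V → A} {x₀ : V} (P' : V →L[𝕜] A) (hP : HasStrictFDerivAt P P' x₀)
    (s : A →L[𝕜] V) (hs : ∀ a, P' (s a) = a)
    {Λ : ℕ → AddSubgroup V} {r γ : ℝ} (hΛ : ∀ j, (Λ j : Set V) = closedBall (0 : V) (r * γ ^ j)) (hr : 0 < r) (hγ0 : 0 < γ) (hγ1 : γ < 1) :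
    ∃ k₀ : ℕ, ∀ k, k₀ ≤ k → P '' (x₀ +ᵥ (Λ k : Set V)) = P x₀ +ᵥ (P' : V → A) '' (Λ k : Set V) := by
  obtain ⟨e, Ψ, hΨd, hΨ1, hfst, -⟩ := exists_splitting_chart P' s hs hP
  obtain ⟨k₀, hk₀⟩ := exists_depth_injOn_image e hΨd hΛ hr hγ0 hγ1
  refine ⟨k₀, fun k hk => ?_⟩
  have h := (hk₀ k hk).2 k le_rfl 0 (Λ k).zero_mem
  simp only [add_zero] at h
  have h1 := congrArg (fun S : Set (A × _) => Prod.fst '' S) h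
  simp only [Set.image_image, hΨ1] at h1
  rw [h1]
  ext a
  simp only [Set.mem_image, Set.mem_vadd_set, vadd_eq_add]
  constructor
  · rintro ⟨p, ⟨w, ⟨v, hv, rfl⟩, rfl⟩, rfl⟩
    exact ⟨P' v, ⟨v, hv, rfl⟩, by simp [hΨ1, hfst]⟩
  · rintro ⟨b, ⟨v, hv, rfl⟩, rfl⟩
    exact ⟨Ψ x₀ + e v, ⟨e v, ⟨v, hv, rfl⟩, rfl⟩, by simp [hΨ1, hfst]⟩

variable [MeasurableSpace V] [BorelSpace V] [MeasurableSpace A] [BorelSpace A]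
  (μ : Measure V) [IsFiniteMeasureOnCompacts μ] [μ.IsAddLeftInvariant]

/-- **Submersion chart.**  Let `P : V → A` have strict derivative `P′` at `x₀`, `V` ultrametric proper, and let `s : A →L[𝕜] V` be a continuous linear right inverse of `P′`
(`P′ (s a) = a`; exists whenever `P′` is onto and `A` finite-dimensional).  Then for every ball filtration `Λ j = closedBall 0 (rγʲ)` there is a depth `k₀` such that for all
`k ≥ k₀`: (a) `P '' (x₀ +ᵥ Λ k) = P x₀ +ᵥ P′ '' Λ k`; (b) `∫⁻ v in Λ k, f (P (x₀ + v)) ∂μ = ∫⁻ v in Λ k, f (P x₀ + P′ v) ∂μ` for every measurable `f : A → ℝ≥0∞` —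
a submersion integrates like its affine linearisation on small boxes. [cite: Schikhof1984, §27 Lemma 27.4–Thm. 27.5] [cite: Serre1992LALG, Part II Ch. III §10] -/
theorem exists_depth_submersion {P : V → A} {x₀ : V} (P' : V →L[𝕜] A) (hP : HasStrictFDerivAt P P' x₀)
    (s : A →L[𝕜] V) (hs : ∀ a, P' (s a) = a)
    {Λ : ℕ → AddSubgroup V} {r γ : ℝ} (hΛ : ∀ j, (Λ j : Set V) = closedBall (0 : V) (r * γ ^ j)) (hr : 0 < r) (hγ0 : 0 < γ) (hγ1 : γ < 1) :
    ∃ k₀ : ℕ, ∀ k, k₀ ≤ k →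
      P '' (x₀ +ᵥ (Λ k : Set V)) = P x₀ +ᵥ (P' : V → A) '' (Λ k : Set V) ∧
      (∀ f : A → ℝ≥0∞, Measurable f → ∫⁻ v in (Λ k : Set V), f (P (x₀ + v)) ∂μ = ∫⁻ v in (Λ k : Set V), f (P x₀ + P' v) ∂μ) := by
  obtain ⟨e, Ψ, hΨd, hΨ1, hfst, -⟩ := exists_splitting_chart P' s hs hP
  obtain ⟨k₀, hk₀⟩ := exists_depth_chart μ e hΨd hΛ hr hγ0 hγ1
  obtain ⟨k₁, hk₁⟩ := exists_depth_image_box_eq_linear P' hP s hs hΛ hr hγ0 hγ1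
  refine ⟨max k₀ k₁, fun k hk => ⟨hk₁ k (le_of_max_le_right hk), fun f hf => ?_⟩⟩
  obtain ⟨-, -, -, hlin⟩ := hk₀ k (le_of_max_le_left hk)
  have h := hlin (fun p => f p.1) (hf.comp measurable_fst)
  simpa [hΨ1, hfst] using h

/-- **Integration formula alone** (by-name use): `∫⁻ v in Λ k, f (P (x₀ + v)) ∂μ = ∫⁻ v in Λ k, f (P x₀ + P′ v) ∂μ`, `k ≥ k₀`.
[cite: Schikhof1984, §27 Lemma 27.4–Thm. 27.5] -/
theorem exists_depth_lintegral_comp_eq_linear {P : V → A} {x₀ : V} (P' : V →L[𝕜] A) (hP : HasStrictFDerivAt P P' x₀)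
    (s : A →L[𝕜] V) (hs : ∀ a, P' (s a) = a)
    {Λ : ℕ → AddSubgroup V} {r γ : ℝ} (hΛ : ∀ j, (Λ j : Set V) = closedBall (0 : V) (r * γ ^ j)) (hr : 0 < r) (hγ0 : 0 < γ) (hγ1 : γ < 1) :
    ∃ k₀ : ℕ, ∀ k, k₀ ≤ k → ∀ f : A → ℝ≥0∞, Measurable f →
      ∫⁻ v in (Λ k : Set V), f (P (x₀ + v)) ∂μ = ∫⁻ v in (Λ k : Set V), f (P x₀ + P' v) ∂μ := by
  obtain ⟨k₀, h⟩ := exists_depth_submersion μ P' hP s hs hΛ hr hγ0 hγ1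
  exact ⟨k₀, fun k hk => (h k hk).2⟩

end Summit.HodgeConjecture.HodgeConjecture.Cruxes.H413.F0P3cStCharTSSubmersionChart

end
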